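import Summits.QuantumFields.YangMills.Theorems.FixedTorusFirstTorusComparison
import Summits.QuantumFields.YangMills.Theorems.ConvexGribovBodyNonSimplyConnectedLatticeGapStubCellFiniteSizeSmallBeta
import Summits.QuantumFields.YangMills.Theorems.IR.ShellMaxCorrStrongCouplingClustering
import HarnessLib

/-!
# `FixedTorusFirst` — BC5 rung of the crux `FiniteSizeInsensitivity`:
# torus-size insensitivity of connected correlations at strong coupling

Route `route-QuantumFields-FixedTorusFirst` (a sub-line under `BalabanLadder.NT`, ladder rung R2a),
crux `Summit.QuantumFields.YangMills.Theses.FixedTorusFirst.FiniteSizeInsensitivity`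
(item `stmt-QuantumFields-27355`).  The tribunal's T3 witness for that crux was registered
PLAN-ONLY as `Cruxes.FiniteSizeInsensitivity.Rung.stub_rung_strongCouplingFiniteSize`; this file
PROVES it — the identical statement — for every compact Hausdorff second-countable gauge group `G`
and every continuous matrix representation `ρ`.

THEOREM (`rung_strongCouplingFiniteSize`).  There is `β₀ > 0` (depending on `ρ`) such that for all
gauge-invariant bounded local observables `A, B` there are `C` and `c > 0` with
`|corr_{2S+1}(A, τ_n B; β) − corr_{2S'+1}(A, τ_n B; β)| ≤ C e^{−c S}` for all `|β| ≤ β₀` and all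
`n ≤ S ≤ S'`: the connected two-point function on the odd torus `(ℤ/(2S+1))⁴` is insensitive to
the torus size, exponentially in the SMALLER size, uniformly in the separation `n ≤ S`.
Here `corr_M = latticeConnectedCorr ρ β M` (lattice units, periodic lift).

PROOF (lattice units throughout; NO continuum limit, NO mass gap, NO `NT`, NO summit statement is
proved here).  Two regimes, rate `c = log 2 / 12`.
* `2n ≤ S` (and `S ≥ 2(R_A+R_B)+8`): the product observable `F_n = A · τ_n B` is a bounded
  measurable cylinder function of sup-radius `R = R_A + R_B + n`; with `k = ⌊(S − 1 − R)/3⌋ ≥ 1`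
  the cube `Λ` of radius `R + 3k ≤ S − 1` (plus its collar) embeds injectively in BOTH tori.  By
  the torus DLR equation (`integral_torusLift_mul_eq_integral_ymSpecification_mul_of_measurable`,
  far factor `H = 1`) the torus mean of `F_n` on either torus is the torus average of the
  box-kernel mean `γ_Λ F_n`; the Dobrushin–Shlosman finite-size condition at strong coupling
  (`NonSimplyConnectedLatticeGap.stub_cellFiniteSize_smallBeta`, cells of side `3`, `ε = 1/3552`,
  so `q = ε · (7⁴ − 5⁴) = 1/2`) and the influence chain rule
  (`FiniteSizeCriterion.box_influence_le`)
  make `γ_Λ F_n` oscillate by at most `2‖A‖‖B‖(2R+1)⁴ 2^{−k}` over ALL exterior conditions, so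
  the two torus means differ by at most that (`abs_torusMean_sub_torusMean_le`); likewise for `A`
  and `B` alone, whence the product of means.  The polynomial `(2R+1)⁴ ≤ (2S+1)⁴` is absorbed by
  `x⁴ ≤ (4/δ)⁴ e^{δx}` (`pow_four_le_mul_exp`).  Small `S` is covered by the trivial bound.
* `2n > S`: each connected correlation is `≤ C e^{−(log 2/6) n} ≤ C e^{−(log 2/12) S}` by the
  strong-coupling clustering theorem `ShellMaxCorr.strongCoupling_clustering`.

This is the classical volume-independence of strong-coupling lattice gauge theory
[cite: OsterwalderSeiler1978, §2 and Thm. 3.5], obtained here from the Dobrushin–Shlosman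
finite-size machinery [cite: DobrushinShlosman1985, §2] and the DLR formalism
[cite: Georgii2011, §8.2] already in the tree.  It exercises the route's lever (torus-size
insensitivity feeding `SomeTorusFloors → NT`) in the one regime where it is a theorem today; it
says nothing about the weak-coupling / physical-scale regime over which the crux
`FiniteSizeInsensitivity` quantifies.
-/

set_option autoImplicit false

noncomputable section

open MeasureTheory Filter
open Literature.Probability.LatticeModels
open Literature.MathematicalPhysics.QuantumLattice
open Literature.MathematicalPhysics.QuantumFieldTheory (wilsonMeasure
  isProbabilityMeasure_wilsonMeasure latticeConnectedCorr measurable_torusLift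
  isSpecification_ymSpecification_of_t2Space)
open Summit.QuantumFields.YangMills.Theorems.FiniteSizeCriterion
open Summit.QuantumFields.YangMills.Theorems.NonSimplyConnectedLatticeGap (stub_cellFiniteSize_smallBeta)
open Summit.QuantumFields.YangMills.Cruxes.IR.ShellMaxCorr (strongCoupling_clustering)

namespace Summit.QuantumFields.YangMills.Cruxes.FiniteSizeInsensitivity.Rung

section Torus

variable {N : ℕ} {G : Type} [Group G] [TopologicalSpace G] [IsTopologicalGroup G]
  [CompactSpace G] [T2Space G] [SecondCountableTopology G] [MeasurableSpace G] [BorelSpace G]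


/-! ## The rung -/

/-- **BC5 rung of `FixedTorusFirst.FiniteSizeInsensitivity`, strong coupling, every compact `G`.**
The statement registered plan-only as `stub_rung_strongCouplingFiniteSize`: there is `β₀ > 0`
such that for all gauge-invariant bounded local observables `A, B` there are `C` and `c > 0` with
`|corr_{2S+1}(A, τ_n B; β) − corr_{2S'+1}(A, τ_n B; β)| ≤ C e^{−cS}` for `|β| ≤ β₀`, `n ≤ S ≤ S'`.
Lattice units; `c = log 2 / 12`.  Dobrushin–Shlosman finite-size condition + torus DLR for
`2n ≤ S`, strong-coupling clustering for `2n > S` (see the module docstring). -/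
theorem rung_strongCouplingFiniteSize {m : ℕ} (ρ : G →* Matrix (Fin m) (Fin m) ℂ)
    (hρ : Continuous ρ) :
    ∃ β₀ : ℝ, 0 < β₀ ∧ ∀ A B : LocalGaugeObservable 4 G, ∃ C c : ℝ, 0 < c ∧
      ∀ β : ℝ, |β| ≤ β₀ → ∀ S S' n : ℕ, n ≤ S → S ≤ S' →
        |latticeConnectedCorr ρ β (2 * S + 1) A.F B.F n -
            latticeConnectedCorr ρ β (2 * S' + 1) A.F B.F n| ≤ C * Real.exp (-(c * S)) := by
  classical
  -- the two strong-coupling inputs: the DS finite-size condition and clustering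
  obtain ⟨β₁, hβ₁, hFS⟩ :=
    stub_cellFiniteSize_smallBeta G m ρ hρ ((1 : ℝ) / 3552) (by norm_num)
  obtain ⟨β₂, hβ₂, hcl⟩ :=
    strongCoupling_clustering ρ hρ
  refine ⟨min (β₁ / 2) β₂, lt_min (by linarith) hβ₂, ?_⟩
  intro A B
  obtain ⟨Ccl, hCcl⟩ := hcl A B
  obtain ⟨CA, hCA⟩ := A.bounded
  obtain ⟨CB, hCB⟩ := B.bounded
  have hCA0 : 0 ≤ CA := (abs_nonneg _).trans (hCA fun _ => 1)
  have hCB0 : 0 ≤ CB := (abs_nonneg _).trans (hCB fun _ => 1)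
  -- the radii of the supports
  set RA : ℕ := A.supp.sup fun e => Finset.univ.sup fun i => (e.1 i).natAbs
  set RB : ℕ := B.supp.sup fun e => Finset.univ.sup fun i => (e.1 i).natAbs
  have hRA : ∀ e ∈ A.supp, ∀ i, |e.1 i| ≤ RA := fun e he i => by
    rw [Int.abs_eq_natAbs, Int.ofNat_le]
    exact (Finset.le_sup (f := fun i => (e.1 i).natAbs) (Finset.mem_univ i)).trans
      (Finset.le_sup (f := fun e : ZdEdge 4 => Finset.univ.sup fun i => (e.1 i).natAbs) he)
  have hRB : ∀ e ∈ B.supp, ∀ i, |e.1 i| ≤ RB := fun e he i => by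
    rw [Int.abs_eq_natAbs, Int.ofNat_le]
    exact (Finset.le_sup (f := fun i => (e.1 i).natAbs) (Finset.mem_univ i)).trans
      (Finset.le_sup (f := fun e : ZdEdge 4 => Finset.univ.sup fun i => (e.1 i).natAbs) he)
  clear_value RA RB
  -- the rate and the constants
  have hlog2 : 0 < Real.log 2 := Real.log_pos (by norm_num)
  obtain ⟨c, hc⟩ : ∃ c : ℝ, c = Real.log 2 / 12 := ⟨_, rfl⟩
  have hc0 : 0 < c := by rw [hc]; positivity
  obtain ⟨K₁, hK₁⟩ : ∃ K₁ : ℝ, K₁ = (4 / (Real.log 2 / 24)) ^ 4 * Real.exp (Real.log 2 / 24) :=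
    ⟨_, rfl⟩
  obtain ⟨K₂, hK₂⟩ : ∃ K₂ : ℝ, K₂ = Real.exp ((RA + RB + 3 : ℝ) * Real.log 2 / 3) := ⟨_, rfl⟩
  have hK₁0 : 0 ≤ K₁ := by rw [hK₁]; positivity
  have hK₂0 : 0 ≤ K₂ := by rw [hK₂]; positivity
  obtain ⟨C, hC⟩ : ∃ C : ℝ, C = 2 * max Ccl 0 +
      4 * CA * CB * Real.exp (c * (2 * (RA + RB : ℝ) + 8)) + 6 * CA * CB * (K₁ * K₂) := ⟨_, rfl⟩
  have hCcl0 : 0 ≤ max Ccl 0 := le_max_right _ _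
  have hT1 : 2 * max Ccl 0 ≤ C := by
    have h2 : 0 ≤ 4 * CA * CB * Real.exp (c * (2 * (RA + RB : ℝ) + 8)) := by positivity
    have h3 : 0 ≤ 6 * CA * CB * (K₁ * K₂) := by positivity
    rw [hC]; linarith
  have hT2 : 4 * CA * CB * Real.exp (c * (2 * (RA + RB : ℝ) + 8)) ≤ C := by
    have h1 : 0 ≤ 2 * max Ccl 0 := by positivity
    have h3 : 0 ≤ 6 * CA * CB * (K₁ * K₂) := by positivity
    rw [hC]; linarith
  have hT3 : 6 * CA * CB * (K₁ * K₂) ≤ C := by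
    have h1 : 0 ≤ 2 * max Ccl 0 := by positivity
    have h2 : 0 ≤ 4 * CA * CB * Real.exp (c * (2 * (RA + RB : ℝ) + 8)) := by positivity
    rw [hC]; linarith
  refine ⟨C, c, hc0, ?_⟩
  intro β hβ S S' n hnS hSS'
  have hβ1 : |β| < β₁ := lt_of_le_of_lt (hβ.trans (min_le_left _ _)) (by linarith)
  have hβ2 : |β| ≤ β₂ := hβ.trans (min_le_right _ _)
  haveI := isProbabilityMeasure_wilsonMeasure (d := 4) (L := 2 * S + 1) ρ hρ β
  haveI := isProbabilityMeasure_wilsonMeasure (d := 4) (L := 2 * S' + 1) ρ hρ β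
  have hexp0 : 0 < Real.exp (-(c * S)) := Real.exp_pos _
  by_cases hn : 2 * n ≤ S
  swap
  · -- regime `2n > S`: clustering on each torus separately
    have h1 := hCcl β hβ2 S n hnS
    have h2 := hCcl β hβ2 S' n (hnS.trans hSS')
    have hnS' : (S : ℝ) ≤ 2 * n := by exact_mod_cast (not_le.1 hn).le
    have he : Real.exp (-(Real.log 2 / 6 * n)) ≤ Real.exp (-(c * S)) := by
      rw [Real.exp_le_exp]
      have h := mul_le_mul_of_nonneg_left hnS' hlog2.le
      rw [hc]; linarith
    have hb : Ccl * Real.exp (-(Real.log 2 / 6 * n)) ≤ max Ccl 0 * Real.exp (-(c * S)) :=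
      calc Ccl * Real.exp (-(Real.log 2 / 6 * n))
          ≤ max Ccl 0 * Real.exp (-(Real.log 2 / 6 * n)) :=
            mul_le_mul_of_nonneg_right (le_max_left _ _) (Real.exp_pos _).le
        _ ≤ max Ccl 0 * Real.exp (-(c * S)) := mul_le_mul_of_nonneg_left he hCcl0
    calc _ ≤ |latticeConnectedCorr ρ β (2 * S + 1) A.F B.F n| +
          |latticeConnectedCorr ρ β (2 * S' + 1) A.F B.F n| := abs_sub _ _
      _ ≤ max Ccl 0 * Real.exp (-(c * S)) + max Ccl 0 * Real.exp (-(c * S)) :=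
          add_le_add (h1.trans hb) (h2.trans hb)
      _ = (2 * max Ccl 0) * Real.exp (-(c * S)) := by ring
      _ ≤ C * Real.exp (-(c * S)) := mul_le_mul_of_nonneg_right hT1 hexp0.le
  by_cases hsmall : S < 2 * (RA + RB) + 8
  · -- few sites: the trivial bound suffices
    have h1 := abs_latticeConnectedCorr_le_two_mul ρ hρ β (2 * S + 1) hCA hCB n
    have h2 := abs_latticeConnectedCorr_le_two_mul ρ hρ β (2 * S' + 1) hCA hCB n
    have he : 1 ≤ Real.exp (c * (2 * (RA + RB : ℝ) + 8)) * Real.exp (-(c * S)) := by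
      rw [← Real.exp_add]
      refine Real.one_le_exp ?_
      have h : (S : ℝ) ≤ 2 * (RA + RB : ℝ) + 8 := by exact_mod_cast hsmall.le
      have h' := mul_le_mul_of_nonneg_left h hc0.le
      linarith
    calc _ ≤ |latticeConnectedCorr ρ β (2 * S + 1) A.F B.F n| +
          |latticeConnectedCorr ρ β (2 * S' + 1) A.F B.F n| := abs_sub _ _
      _ ≤ 2 * CA * CB + 2 * CA * CB := add_le_add h1 h2
      _ = 4 * CA * CB * 1 := by ring
      _ ≤ 4 * CA * CB * (Real.exp (c * (2 * (RA + RB : ℝ) + 8)) * Real.exp (-(c * S))) :=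
          mul_le_mul_of_nonneg_left he (by positivity)
      _ = (4 * CA * CB * Real.exp (c * (2 * (RA + RB : ℝ) + 8))) * Real.exp (-(c * S)) := by
          ring
      _ ≤ C * Real.exp (-(c * S)) := mul_le_mul_of_nonneg_right hT2 hexp0.le
  -- the main regime: a box of `k ≈ S/6` recursion steps around the supports fits in both tori
  rw [not_lt] at hsmall
  obtain ⟨R, hR⟩ : ∃ R : ℕ, R = RA + RB + n := ⟨_, rfl⟩
  obtain ⟨k, hk⟩ : ∃ k : ℕ, k = (S - 1 - R) / 3 := ⟨_, rfl⟩
  have hk3 : k * 3 ≤ S - 1 - R := by rw [hk]; exact Nat.div_mul_le_self _ _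
  have hklt : S - 1 - R < k * 3 + 3 := by rw [hk]; exact Nat.lt_div_mul_add (by norm_num)
  obtain ⟨L, hL⟩ : ∃ L : ℕ, L = R + k * (2 * 1 + 1) := ⟨_, rfl⟩
  have hL3 : L = R + 3 * k := by rw [hL]; ring
  have hRS : R + 1 ≤ S := by omega
  have hLS : L + 1 ≤ S := by omega
  have hRL' : R ≤ L := by omega
  have hI1 : (L : ℤ) + 1 ≤ S := by exact_mod_cast hLS
  have hI2 : (S : ℤ) ≤ S' := by exact_mod_cast hSS'
  have hRL : (R : ℤ) ≤ L := by exact_mod_cast hRL'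
  -- the product observable `F_n = A · τ_n B`, its support and radius
  have hcs := (Literature.MathematicalPhysics.QuantumLattice.configShift (G := G) (d := 4)
    (-Pi.single 0 (n : ℤ))).measurable
  have hFm : Measurable fun U : LGConfig 4 G =>
      A.F U * B.F (configShift (-Pi.single 0 (n : ℤ)) U) :=
    A.measurable.mul (B.measurable.comp hcs)
  have hFb : ∀ U : LGConfig 4 G,
      |A.F U * B.F (configShift (-Pi.single 0 (n : ℤ)) U)| ≤ CA * CB := fun U => by
      rw [abs_mul]
      exact mul_le_mul (hCA _) (hCB _) (abs_nonneg _) hCA0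
  have hFS' : IsCylinder
      (fun U : LGConfig 4 G => A.F U * B.F (configShift (-Pi.single 0 (n : ℤ)) U))
      (A.supp ∪ B.supp.image fun e : ZdEdge 4 => (e.1 - -Pi.single 0 (n : ℤ), e.2)) :=
    Literature.MathematicalPhysics.QuantumFieldTheory.IsCylinder.mul A.isCylinder
      (Literature.MathematicalPhysics.QuantumFieldTheory.IsCylinder.comp_configShift
        B.isCylinder _)
  have hsingle : ∀ i : Fin 4, |(-Pi.single 0 (n : ℤ) : Site 4) i| ≤ n := fun i => by
    rw [Pi.neg_apply, abs_neg]
    by_cases hi : i = 0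
    · subst hi
      simp
    · rw [Pi.single_eq_of_ne hi]
      simp
  have hRAR' : (RA : ℤ) ≤ R := by exact_mod_cast (by omega : RA ≤ R)
  have hRBn : (RB : ℤ) + n ≤ R := by exact_mod_cast (by omega : RB + n ≤ R)
  have hRAR : ∀ e ∈ A.supp, ∀ i, |e.1 i| ≤ R := fun e he i => (hRA e he i).trans hRAR'
  have hRBR : ∀ e ∈ B.supp, ∀ i, |e.1 i| ≤ R := fun e he i =>
    (hRB e he i).trans (by have h0 : (0 : ℤ) ≤ n := Nat.cast_nonneg n; linarith)
  have hRF : ∀ e ∈ A.supp ∪ B.supp.image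
      (fun e : ZdEdge 4 => (e.1 - -Pi.single 0 (n : ℤ), e.2)), ∀ i, |e.1 i| ≤ R := by
    intro e he i
    rcases Finset.mem_union.1 he with he | he
    · exact hRAR e he i
    · obtain ⟨e₀, he₀, rfl⟩ := Finset.mem_image.1 he
      have h1 := hRB e₀ he₀ i
      have h2 := hsingle i
      have hsub : ((e₀.1 - -Pi.single 0 (n : ℤ), e₀.2) : ZdEdge 4).1 i =
          e₀.1 i - (-Pi.single 0 (n : ℤ) : Site 4) i := rfl
      rw [hsub]
      calc |e₀.1 i - (-Pi.single 0 (n : ℤ) : Site 4) i|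
          ≤ |e₀.1 i| + |(-Pi.single 0 (n : ℤ) : Site 4) i| := abs_sub _ _
        _ ≤ RB + n := add_le_add h1 h2
        _ ≤ R := hRBn
  -- the box `Λ` of radius `L` and its geometry
  obtain ⟨Λ, hΛ⟩ : ∃ Λ : Finset (ZdEdge 4), Λ = (Fintype.piFinset fun _ : Fin 4 =>
    Finset.Ico (-(((1 : ℕ) : ℤ) * L)) (((1 : ℕ) : ℤ) * (L + 1))) ×ˢ
      (Finset.univ : Finset (Fin 4)) := ⟨_, rfl⟩
  have hmemΛ : ∀ e ∈ Λ, ∀ i, -(L : ℤ) ≤ e.1 i ∧ e.1 i ≤ L := by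
    intro e he i
    rw [hΛ, Finset.mem_product, Fintype.mem_piFinset] at he
    have h := Finset.mem_Ico.1 (he.1 i)
    simp only [Nat.cast_one, one_mul] at h
    omega
  have hwide : ∀ T : Finset (ZdEdge 4), (∀ e ∈ T, ∀ i, |e.1 i| ≤ R) →
      ∀ e ∈ Λ ∪ T ∪ (plaquettesTouching Λ).biUnion plaquetteEdges, ∀ i,
        -(L : ℤ) - 1 ≤ e.1 i ∧ e.1 i ≤ L + 1 := by
    intro T hT e he i
    simp only [Finset.mem_union] at he
    rcases he with (he | he) | he
    · have h := hmemΛ e he i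
      omega
    · have h := abs_le.1 (hT e he i)
      omega
    · obtain ⟨e', he', hn'⟩ := exists_near_of_mem_collar he
      have h := hmemΛ e' he' i
      have h' := hn' i
      omega
  have hinj : ∀ M : ℕ, (S : ℤ) ≤ M → ∀ T : Finset (ZdEdge 4), (∀ e ∈ T, ∀ i, |e.1 i| ≤ R) →
      Set.InjOn (Torus.proj (2 * M + 1))
        ((Λ ∪ T ∪ (plaquettesTouching Λ).biUnion plaquetteEdges).image Prod.fst :
          Set (Site 4)) := by
    intro M hM T hT
    refine (injOn_torusProj_of_width (M := 2 * M + 1) (lo := -(L : ℤ) - 1) (hi := (L : ℤ) + 1)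
      (by push_cast; linarith only [hI1, hM])).mono fun x hx => ?_
    obtain ⟨e, he, rfl⟩ := Finset.mem_image.1 (Finset.mem_coe.1 hx)
    exact hwide T hT e he
  have hSS : (S : ℤ) ≤ S := le_rfl
  -- the three influence bounds on `ℤ⁴`
  have hε : (0 : ℝ) ≤ 1 / 3552 := by norm_num
  have hinflF := box_influence_le ρ hρ β (b := 1) (n := 1) le_rfl hε (hFS β hβ1) k R hFm hFb
    hFS' hRF
  have hinflA := box_influence_le ρ hρ β (b := 1) (n := 1) le_rfl hε (hFS β hβ1) k R
    A.measurable hCA A.isCylinder hRAR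
  have hinflB := box_influence_le ρ hρ β (b := 1) (n := 1) le_rfl hε (hFS β hβ1) k R
    B.measurable hCB B.isCylinder hRBR
  rw [← hL, ← hΛ] at hinflF hinflA hinflB
  have hq :
      (1 / 3552 * ((((2 * (2 * 1 + 1) + 1) ^ 4 - (2 * (2 * 1) + 1) ^ 4 : ℕ)) : ℝ)) = 1 / 2 := by
    norm_num
  rw [hq] at hinflF hinflA hinflB
  -- one-point comparisons across the two tori
  have hΔF := abs_torusMean_sub_torusMean_le ρ hρ β Λ hFm hFb hFS' (2 * S + 1) (2 * S' + 1)
    (hinj S hSS _ hRF) (hinj S' hI2 _ hRF) hinflF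
  have hΔA := abs_torusMean_sub_torusMean_le ρ hρ β Λ A.measurable hCA A.isCylinder (2 * S + 1)
    (2 * S' + 1) (hinj S hSS _ hRAR) (hinj S' hI2 _ hRAR) hinflA
  have hΔB := abs_torusMean_sub_torusMean_le ρ hρ β Λ B.measurable hCB B.isCylinder (2 * S + 1)
    (2 * S' + 1) (hinj S hSS _ hRBR) (hinj S' hI2 _ hRBR) hinflB
  -- the factor `(2R+1)⁴ 2^{-k}` against `e^{-cS}`
  have hmain : (2 * R + 1 : ℝ) ^ 4 * (1 / 2 : ℝ) ^ k ≤ K₁ * K₂ * Real.exp (-(c * S)) := by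
    have hRSr : (2 * R + 1 : ℝ) ≤ 2 * S + 1 := by
      have h : (R : ℝ) ≤ S := by exact_mod_cast (by omega : R ≤ S)
      linarith
    have hp1 : (2 * R + 1 : ℝ) ^ 4 ≤ (2 * S + 1 : ℝ) ^ 4 := pow_le_pow_left₀ (by positivity) hRSr 4
    have hp2 : (2 * S + 1 : ℝ) ^ 4 ≤ K₁ * Real.exp (Real.log 2 / 12 * S) := by
      have h := pow_four_le_mul_exp (δ := Real.log 2 / 24) (by positivity) (x := 2 * S + 1)
        (by positivity)
      calc (2 * S + 1 : ℝ) ^ 4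
          ≤ (4 / (Real.log 2 / 24)) ^ 4 * Real.exp (Real.log 2 / 24 * (2 * S + 1)) := h
        _ = K₁ * Real.exp (Real.log 2 / 12 * S) := by
            rw [hK₁, mul_assoc, ← Real.exp_add]
            congr 2
            ring
    have hk_lb : (S : ℝ) / 2 - (RA + RB) - 3 ≤ 3 * k := by
      have h1n : S - 1 - R + 1 ≤ k * 3 + 3 := by omega
      have h1 : ((S - 1 - R : ℕ) : ℝ) + 1 ≤ k * 3 + 3 := by exact_mod_cast h1n
      have h2 : ((S - 1 - R : ℕ) : ℝ) = S - 1 - R := by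
        have h : R ≤ S - 1 := by omega
        have h' : 1 ≤ S := by omega
        rw [Nat.cast_sub h, Nat.cast_sub h']
        push_cast
        ring
      have h3 : (R : ℝ) = RA + RB + n := by rw [hR]; push_cast; ring
      have h4 : 2 * (n : ℝ) ≤ S := by exact_mod_cast hn
      linarith
    have hp3 : (1 / 2 : ℝ) ^ k ≤ K₂ * Real.exp (-(Real.log 2 / 6 * S)) := by
      have e1 : (1 / 2 : ℝ) ^ k = Real.exp (-(Real.log 2 * k)) := by
        rw [← Real.exp_log (by norm_num : (0 : ℝ) < 1 / 2), ← Real.exp_nat_mul, one_div,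
          Real.log_inv]
        congr 1
        ring
      rw [hK₂, ← Real.exp_add, e1, Real.exp_le_exp]
      have h := mul_le_mul_of_nonneg_left hk_lb hlog2.le
      linarith
    calc (2 * R + 1 : ℝ) ^ 4 * (1 / 2 : ℝ) ^ k
        ≤ (K₁ * Real.exp (Real.log 2 / 12 * S)) * (K₂ * Real.exp (-(Real.log 2 / 6 * S))) :=
          mul_le_mul (hp1.trans hp2) hp3 (by positivity) (by positivity)
      _ = K₁ * K₂ * (Real.exp (Real.log 2 / 12 * S) * Real.exp (-(Real.log 2 / 6 * S))) := by ring
      _ = K₁ * K₂ * Real.exp (-(c * S)) := by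
          rw [← Real.exp_add]
          congr 2
          rw [hc]
          ring
  -- assembling `corr = ⟨A τ_nB⟩ − ⟨A⟩⟨B⟩` on the two tori
  have key : ∀ P₁ P₂ a₁ a₂ b₁ b₂ X : ℝ, 0 ≤ X → |P₁ - P₂| ≤ 2 * (CA * CB) * X →
      |a₁ - a₂| ≤ 2 * CA * X → |b₁ - b₂| ≤ 2 * CB * X → |a₂| ≤ CA → |b₁| ≤ CB →
      |P₁ - a₁ * b₁ - (P₂ - a₂ * b₂)| ≤ 6 * CA * CB * X := by
    intro P₁ P₂ a₁ a₂ b₁ b₂ X hX hP ha hb ha₂ hb₁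
    have e : P₁ - a₁ * b₁ - (P₂ - a₂ * b₂) = (P₁ - P₂) - ((a₁ - a₂) * b₁ + a₂ * (b₁ - b₂)) := by
      ring
    rw [e]
    have h2X : 0 ≤ 2 * CA * X := by positivity
    calc |P₁ - P₂ - ((a₁ - a₂) * b₁ + a₂ * (b₁ - b₂))|
        ≤ |P₁ - P₂| + |(a₁ - a₂) * b₁ + a₂ * (b₁ - b₂)| := abs_sub _ _
      _ ≤ |P₁ - P₂| + (|(a₁ - a₂) * b₁| + |a₂ * (b₁ - b₂)|) := by
          gcongr
          exact abs_add_le _ _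
      _ = |P₁ - P₂| + (|a₁ - a₂| * |b₁| + |a₂| * |b₁ - b₂|) := by rw [abs_mul, abs_mul]
      _ ≤ 2 * (CA * CB) * X + (2 * CA * X * CB + CA * (2 * CB * X)) :=
          add_le_add hP (add_le_add (mul_le_mul ha hb₁ (abs_nonneg _) h2X)
            (mul_le_mul ha₂ hb (abs_nonneg _) hCA0))
      _ = 6 * CA * CB * X := by ring
  have hX0 : (0 : ℝ) ≤ (2 * R + 1 : ℝ) ^ 4 * (1 / 2 : ℝ) ^ k := by positivity
  have ha₂ : |∫ U, A.F (torusLift (2 * S' + 1) U)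
      ∂(wilsonMeasure (d := 4) (L := 2 * S' + 1) ρ β)| ≤ CA :=
    abs_integral_le_of_abs_le fun U => hCA _
  have hb₁ : |∫ U, B.F (torusLift (2 * S + 1) U)
      ∂(wilsonMeasure (d := 4) (L := 2 * S + 1) ρ β)| ≤ CB :=
    abs_integral_le_of_abs_le fun U => hCB _
  unfold Literature.MathematicalPhysics.QuantumFieldTheory.latticeConnectedCorr
  refine (key _ _ _ _ _ _ _ hX0 hΔF hΔA hΔB ha₂ hb₁).trans ?_
  calc 6 * CA * CB * ((2 * R + 1 : ℝ) ^ 4 * (1 / 2 : ℝ) ^ k)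
      ≤ 6 * CA * CB * (K₁ * K₂ * Real.exp (-(c * S))) :=
        mul_le_mul_of_nonneg_left hmain (by positivity)
    _ = 6 * CA * CB * (K₁ * K₂) * Real.exp (-(c * S)) := by ring
    _ ≤ C * Real.exp (-(c * S)) := mul_le_mul_of_nonneg_right hT3 hexp0.le

end Torus

end Summit.QuantumFields.YangMills.Cruxes.FiniteSizeInsensitivity.Rung

end
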